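import Summits.NavierStokesRegularity.NavierStokesRegularity.Theorems.ExtremiserTransienceLocalMaximiserVariations
import HarnessLib

/-!
# Route `ExtremiserTransience`, crux `NearExtremalTransiencePerFlow` (stmt-NavierStokesRegularity-26567), LINE g10-1 «two_thirds»
# (ns-idea-10 g10), stub S2 `FirstOrderIdentity`: the FIRST VARIATION ALONG A TRUNCATED DIRECTION — pointwise bounds (remainder estimate, part 1)

Helper file for S2 (`--supports stmt-NavierStokesRegularity-26567`).  After the reduction identity (`three_Jg_sub_two_Kg_eq`) the
two-thirds defect contains the term `a₁(χ·G)` with `G = V − curl ψ = ∇q` the harmonic remainder of the gauge, small together with its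
derivatives on the support of the weight `χ` (far-field bounds, `…TwoThirdsGaugeFar`).  This file bounds `|a₁(χ·G)|` for an
ARBITRARY smooth field `G` in terms of pointwise bounds of `G, DG, D²G` on a set `T ⊇ tsupport χ`, of `χ, Dχ, D²χ` through
indicators of sets `S` (where `χ ≠ 0`) and `L` (where `Dχ ≠ 0`, the layer), of `‖DV‖ ≤ A₁`, and of the three weights
`∫‖ω‖, ∫‖ω‖², ∫√(|Dω|²_F)` over `S` and `L`:

* `abs_a1Integrand_le` — pointwise: `|c₁ − κ⋆(z₁ + w₁)| ≤ (2A₁+κ⋆)·c·m₁·‖ω‖ + m₁·‖ω‖² + 3κ⋆·c·m₂·√wd`, with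
  `m₁ = ‖D(χG)‖`, `m₂ = ‖D²(χG)‖`, `c = ‖curlCLM‖`;
* `norm_iteratedFDeriv_one_smul_le`, `norm_iteratedFDeriv_two_smul_le` — Leibniz: `m₁ ≤ |χ|‖DG‖ + ‖Dχ‖‖G‖`,
  `m₂ ≤ |χ|‖D²G‖ + 2‖Dχ‖‖DG‖ + ‖D²χ‖‖G‖`;
* (the integrated bound `abs_a1_smul_le` follows in `…TwoThirdsRemainder`).

HONEST FRAMING: calculus bookkeeping; nothing about Navier–Stokes regularity or blow-up is proved; S2, the crux ⟨26567⟩ and NS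
regularity are OPEN; no summit is proved by a line. [folklore]
-/

noncomputable section

open scoped Topology InnerProductSpace RealInnerProductSpace ENNReal ContDiff
open MeasureTheory Filter Set Metric
open Literature.Analysis.FluidPDE
open Summit.NavierStokesRegularity.NavierStokesRegularity.Theorems.DepletionLadder.KStar.HalfSpace
open Summit.NavierStokesRegularity.NavierStokesRegularity.Theorems.DepletionLadder
open Summit.NavierStokesRegularity.NavierStokesRegularity.Theorems.NearExtremalTransiencePerFlow.LocalMaximiser

namespace Summit.NavierStokesRegularity.NavierStokesRegularity.Theorems.NearExtremalTransiencePerFlow.TwoThirds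

-- the summit's namespace repeats the problem name by convention (D-0017)
set_option linter.dupNamespace false

variable {V r : E3 → E3}

/-! ## Pointwise bounds for the densities of the first variation -/

/-- `‖curl r x‖ ≤ ‖curlCLM‖·‖D r x‖`. [folklore] -/
theorem norm_curl_le_opNorm_mul (r : E3 → E3) (x : E3) : ‖curl r x‖ ≤ ‖curlCLM‖ * ‖fderiv ℝ r x‖ := by
  rw [curl_eq_curlCLM]
  exact curlCLM.le_opNorm _

/-- `‖D(curl r) x‖ ≤ ‖curlCLM‖·‖D² r x‖` for smooth `r` (`curl r = curlCLM ∘ Dr`). [folklore] -/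
theorem norm_fderiv_curl_le (hr : ContDiff ℝ (⊤ : ℕ∞) r) (x : E3) :
    ‖fderiv ℝ (curl r) x‖ ≤ ‖curlCLM‖ * ‖iteratedFDeriv ℝ 2 r x‖ := by
  have e : curl r = curlCLM ∘ fderiv ℝ r := curl_eq_curlCLM_comp r
  have hDr : ContDiff ℝ (⊤ : ℕ∞) (fderiv ℝ r) := (contDiff_infty_iff_fderiv.1 hr).2
  have h1 : ‖fderiv ℝ (curl r) x‖ = ‖iteratedFDeriv ℝ 1 (curlCLM ∘ fderiv ℝ r) x‖ := by
    rw [norm_iteratedFDeriv_one, ← e]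
  have h2 : ‖iteratedFDeriv ℝ 1 (fderiv ℝ r) x‖ = ‖iteratedFDeriv ℝ 2 r x‖ :=
    norm_iteratedFDeriv_fderiv (𝕜 := ℝ) (n := 1) (f := r) (x := x)
  rw [h1, ← h2]
  exact ContinuousLinearMap.norm_iteratedFDeriv_comp_left curlCLM (hDr.contDiffAt) (by exact_mod_cast le_top)

/-- `‖Dω x‖ ≤ √(wd V x)` (operator norm versus Frobenius norm). [folklore] -/
theorem norm_fderiv_curl_le_sqrt_wd (V : E3 → E3) (x : E3) : ‖fderiv ℝ (curl V) x‖ ≤ Real.sqrt (wd V x) := by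
  unfold wd
  exact Real.le_sqrt_of_sq_le (sq_opNorm_le_frobeniusNormSq _)

/-- **Pointwise bound for the `a₁`-density** along a direction `r` at a smooth field `V` with `‖DV x‖ ≤ A₁`:
`|c₁ − (κ⋆/2)(2z₁ + 2w₁)| ≤ (2A₁+κ⋆)·c·m₁·‖ω‖ + m₁·‖ω‖² + 3κ⋆·c·m₂·√wd`, `m₁ = ‖Dr x‖`, `m₂ = ‖D²r x‖`, `c = ‖curlCLM‖`.
[folklore] -/
theorem abs_a1Integrand_le (hr : ContDiff ℝ (⊤ : ℕ∞) r) {A₁ : ℝ} {x : E3} (hA : ‖fderiv ℝ V x‖ ≤ A₁) :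
    |c1 V r x - (kStar / 2) * ((1 : ℝ)⁻¹ * (2 * z1 V r x) + 1 * (2 * w1 V r x))| ≤
      (2 * A₁ + kStar) * ‖curlCLM‖ * ‖fderiv ℝ r x‖ * ‖curl V x‖ + ‖fderiv ℝ r x‖ * ‖curl V x‖ ^ 2 +
        3 * kStar * ‖curlCLM‖ * ‖iteratedFDeriv ℝ 2 r x‖ * Real.sqrt (wd V x) := by
  have hK : 0 < kStar := kStar_pos
  have hc0 : 0 ≤ ‖curlCLM‖ := norm_nonneg curlCLM
  have hA0 : 0 ≤ A₁ := (norm_nonneg _).trans hA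
  set w₀ := curl V x with hw₀
  set m₁ := ‖fderiv ℝ r x‖ with hm₁
  set m₂ := ‖iteratedFDeriv ℝ 2 r x‖ with hm₂
  have hcr : ‖curl r x‖ ≤ ‖curlCLM‖ * m₁ := norm_curl_le_opNorm_mul r x
  have hDcr : ‖fderiv ℝ (curl r) x‖ ≤ ‖curlCLM‖ * m₂ := norm_fderiv_curl_le hr x
  have hDω : ‖fderiv ℝ (curl V) x‖ ≤ Real.sqrt (wd V x) := norm_fderiv_curl_le_sqrt_wd V x
  -- `c₁`
  have h1 : |c1 V r x| ≤ 2 * A₁ * ‖curlCLM‖ * m₁ * ‖w₀‖ + m₁ * ‖w₀‖ ^ 2 := by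
    unfold c1
    have t1 : |⟪curl r x, fderiv ℝ V x w₀⟫| ≤ ‖curlCLM‖ * m₁ * (A₁ * ‖w₀‖) := by
      calc |⟪curl r x, fderiv ℝ V x w₀⟫| ≤ ‖curl r x‖ * ‖fderiv ℝ V x w₀‖ := abs_real_inner_le_norm _ _
        _ ≤ (‖curlCLM‖ * m₁) * (A₁ * ‖w₀‖) :=
            mul_le_mul hcr ((ContinuousLinearMap.le_opNorm _ _).trans (mul_le_mul_of_nonneg_right hA (norm_nonneg _)))
              (norm_nonneg _) (by positivity)
    have t2 : |⟪w₀, fderiv ℝ r x w₀⟫| ≤ m₁ * ‖w₀‖ ^ 2 := by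
      calc |⟪w₀, fderiv ℝ r x w₀⟫| ≤ ‖w₀‖ * ‖fderiv ℝ r x w₀‖ := abs_real_inner_le_norm _ _
        _ ≤ ‖w₀‖ * (m₁ * ‖w₀‖) := mul_le_mul_of_nonneg_left (ContinuousLinearMap.le_opNorm _ _) (norm_nonneg _)
        _ = m₁ * ‖w₀‖ ^ 2 := by ring
    have t3 : |⟪w₀, fderiv ℝ V x (curl r x)⟫| ≤ ‖w₀‖ * (A₁ * (‖curlCLM‖ * m₁)) := by
      calc |⟪w₀, fderiv ℝ V x (curl r x)⟫| ≤ ‖w₀‖ * ‖fderiv ℝ V x (curl r x)‖ := abs_real_inner_le_norm _ _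
        _ ≤ ‖w₀‖ * (A₁ * (‖curlCLM‖ * m₁)) := by
            refine mul_le_mul_of_nonneg_left ?_ (norm_nonneg _)
            exact (ContinuousLinearMap.le_opNorm _ _).trans (mul_le_mul hA hcr (norm_nonneg _) hA0)
    calc |⟪curl r x, fderiv ℝ V x w₀⟫ + ⟪w₀, fderiv ℝ r x w₀⟫ + ⟪w₀, fderiv ℝ V x (curl r x)⟫|
        ≤ |⟪curl r x, fderiv ℝ V x w₀⟫| + |⟪w₀, fderiv ℝ r x w₀⟫| + |⟪w₀, fderiv ℝ V x (curl r x)⟫| := abs_add_three _ _ _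
      _ ≤ ‖curlCLM‖ * m₁ * (A₁ * ‖w₀‖) + m₁ * ‖w₀‖ ^ 2 + ‖w₀‖ * (A₁ * (‖curlCLM‖ * m₁)) := by gcongr
      _ = 2 * A₁ * ‖curlCLM‖ * m₁ * ‖w₀‖ + m₁ * ‖w₀‖ ^ 2 := by ring
  -- `z₁`
  have h2 : |z1 V r x| ≤ ‖curlCLM‖ * m₁ * ‖w₀‖ := by
    unfold z1
    calc |⟪w₀, curl r x⟫| ≤ ‖w₀‖ * ‖curl r x‖ := abs_real_inner_le_norm _ _
      _ ≤ ‖w₀‖ * (‖curlCLM‖ * m₁) := mul_le_mul_of_nonneg_left hcr (norm_nonneg _)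
      _ = ‖curlCLM‖ * m₁ * ‖w₀‖ := by ring
  -- `w₁`
  have h3 : |w1 V r x| ≤ 3 * ‖curlCLM‖ * m₂ * Real.sqrt (wd V x) := by
    unfold w1
    have hterm : ∀ i : Fin 3, |⟪fderiv ℝ (curl V) x (EuclideanSpace.basisFun (Fin 3) ℝ i),
        fderiv ℝ (curl r) x (EuclideanSpace.basisFun (Fin 3) ℝ i)⟫| ≤ Real.sqrt (wd V x) * (‖curlCLM‖ * m₂) := by
      intro i
      have he : ‖EuclideanSpace.basisFun (Fin 3) ℝ i‖ = 1 := by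
        simp [EuclideanSpace.basisFun_apply]
      calc |⟪fderiv ℝ (curl V) x (EuclideanSpace.basisFun (Fin 3) ℝ i),
            fderiv ℝ (curl r) x (EuclideanSpace.basisFun (Fin 3) ℝ i)⟫|
          ≤ ‖fderiv ℝ (curl V) x (EuclideanSpace.basisFun (Fin 3) ℝ i)‖ *
              ‖fderiv ℝ (curl r) x (EuclideanSpace.basisFun (Fin 3) ℝ i)‖ := abs_real_inner_le_norm _ _
        _ ≤ (‖fderiv ℝ (curl V) x‖ * 1) * (‖fderiv ℝ (curl r) x‖ * 1) := by
            rw [← he]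
            exact mul_le_mul (ContinuousLinearMap.le_opNorm _ _) (ContinuousLinearMap.le_opNorm _ _)
              (norm_nonneg _) (by positivity)
        _ ≤ Real.sqrt (wd V x) * (‖curlCLM‖ * m₂) := by
            rw [mul_one, mul_one]
            exact mul_le_mul hDω hDcr (norm_nonneg _) (Real.sqrt_nonneg _)
    calc |∑ i, ⟪fderiv ℝ (curl V) x (EuclideanSpace.basisFun (Fin 3) ℝ i),
          fderiv ℝ (curl r) x (EuclideanSpace.basisFun (Fin 3) ℝ i)⟫|
        ≤ ∑ i, |⟪fderiv ℝ (curl V) x (EuclideanSpace.basisFun (Fin 3) ℝ i),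
          fderiv ℝ (curl r) x (EuclideanSpace.basisFun (Fin 3) ℝ i)⟫| := Finset.abs_sum_le_sum_abs _ _
      _ ≤ ∑ _i : Fin 3, Real.sqrt (wd V x) * (‖curlCLM‖ * m₂) := Finset.sum_le_sum fun i _ => hterm i
      _ = 3 * ‖curlCLM‖ * m₂ * Real.sqrt (wd V x) := by
          rw [Finset.sum_const, Finset.card_univ, Fintype.card_fin, nsmul_eq_mul]
          push_cast
          ring
  -- combine
  have e : c1 V r x - (kStar / 2) * ((1 : ℝ)⁻¹ * (2 * z1 V r x) + 1 * (2 * w1 V r x)) =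
      c1 V r x - kStar * z1 V r x - kStar * w1 V r x := by ring
  rw [e]
  calc |c1 V r x - kStar * z1 V r x - kStar * w1 V r x|
      ≤ |c1 V r x| + |kStar * z1 V r x| + |kStar * w1 V r x| := by
        have := abs_sub (c1 V r x - kStar * z1 V r x) (kStar * w1 V r x)
        have := abs_sub (c1 V r x) (kStar * z1 V r x)
        linarith
    _ ≤ (2 * A₁ * ‖curlCLM‖ * m₁ * ‖w₀‖ + m₁ * ‖w₀‖ ^ 2) + kStar * (‖curlCLM‖ * m₁ * ‖w₀‖) +
        kStar * (3 * ‖curlCLM‖ * m₂ * Real.sqrt (wd V x)) := by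
        rw [abs_mul, abs_mul, abs_of_pos hK]
        gcongr
    _ = (2 * A₁ + kStar) * ‖curlCLM‖ * m₁ * ‖w₀‖ + m₁ * ‖w₀‖ ^ 2 +
        3 * kStar * ‖curlCLM‖ * m₂ * Real.sqrt (wd V x) := by ring

/-! ## Leibniz bounds for the truncated direction `χ·G` -/

variable {χ : E3 → ℝ} {G : E3 → E3}

/-- `‖D(χG) x‖ ≤ |χ x|·‖DG x‖ + ‖Dχ x‖·‖G x‖`. [folklore] -/
theorem norm_fderiv_smul_le (hχ : ContDiff ℝ (⊤ : ℕ∞) χ) (hG : ContDiff ℝ (⊤ : ℕ∞) G) (x : E3) :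
    ‖fderiv ℝ (fun y => χ y • G y) x‖ ≤ |χ x| * ‖fderiv ℝ G x‖ + ‖fderiv ℝ χ x‖ * ‖G x‖ := by
  have h := norm_iteratedFDeriv_smul_le (𝕜 := ℝ) hχ hG x (n := 1) (by norm_cast)
  rw [norm_iteratedFDeriv_one, Finset.sum_range_succ, Finset.sum_range_succ, Finset.sum_range_zero] at h
  have e0 : ‖iteratedFDeriv ℝ 0 χ x‖ = |χ x| := by rw [norm_iteratedFDeriv_zero, Real.norm_eq_abs]
  have e1 : ‖iteratedFDeriv ℝ (1 - 0) G x‖ = ‖fderiv ℝ G x‖ := norm_iteratedFDeriv_one G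
  have e2 : ‖iteratedFDeriv ℝ 1 χ x‖ = ‖fderiv ℝ χ x‖ := norm_iteratedFDeriv_one χ
  have e3 : ‖iteratedFDeriv ℝ (1 - 1) G x‖ = ‖G x‖ := norm_iteratedFDeriv_zero
  rw [e0, e1, e2, e3] at h
  norm_num [Nat.choose] at h
  linarith

/-- `‖D²(χG) x‖ ≤ |χ x|·‖D²G x‖ + 2‖Dχ x‖·‖DG x‖ + ‖D²χ x‖·‖G x‖`. [folklore] -/
theorem norm_iteratedFDeriv_two_smul_le (hχ : ContDiff ℝ (⊤ : ℕ∞) χ) (hG : ContDiff ℝ (⊤ : ℕ∞) G) (x : E3) :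
    ‖iteratedFDeriv ℝ 2 (fun y => χ y • G y) x‖ ≤
      |χ x| * ‖iteratedFDeriv ℝ 2 G x‖ + 2 * ‖fderiv ℝ χ x‖ * ‖fderiv ℝ G x‖ + ‖iteratedFDeriv ℝ 2 χ x‖ * ‖G x‖ := by
  have h := norm_iteratedFDeriv_smul_le (𝕜 := ℝ) hχ hG x (n := 2) (by norm_cast)
  rw [Finset.sum_range_succ, Finset.sum_range_succ, Finset.sum_range_succ, Finset.sum_range_zero] at h
  have e0 : ‖iteratedFDeriv ℝ 0 χ x‖ = |χ x| := by rw [norm_iteratedFDeriv_zero, Real.norm_eq_abs]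
  have e1 : ‖iteratedFDeriv ℝ (2 - 0) G x‖ = ‖iteratedFDeriv ℝ 2 G x‖ := rfl
  have e2 : ‖iteratedFDeriv ℝ 1 χ x‖ = ‖fderiv ℝ χ x‖ := norm_iteratedFDeriv_one χ
  have e3 : ‖iteratedFDeriv ℝ (2 - 1) G x‖ = ‖fderiv ℝ G x‖ := norm_iteratedFDeriv_one G
  have e4 : ‖iteratedFDeriv ℝ (2 - 2) G x‖ = ‖G x‖ := norm_iteratedFDeriv_zero
  rw [e0, e1, e2, e3, e4] at h
  norm_num [Nat.choose] at h
  linarith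

end Summit.NavierStokesRegularity.NavierStokesRegularity.Theorems.NearExtremalTransiencePerFlow.TwoThirds

end
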